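import Literature.Analysis.FluidPDE.WeakGradientOfL2Limit
import Literature.Analysis.FluidPDE.TaoClassGlue
import Literature.Analysis.FluidPDE.AncientMildCompactness
import Literature.Analysis.FluidPDE.BoundedL2ClassicalMild
import Literature.Analysis.FluidPDE.KNSSTypeIRateLiouvilleMild
import Literature.Analysis.FluidPDE.ClassicalSolutionRescale
import Literature.Analysis.FluidPDE.NSWave0
import Summits.NavierStokesRegularity.NavierStokesRegularity.Theorems.HardyPointSinkHardyAncientLimitClassical
import HarnessLib

/-!
# Route `GaldiLiouvilleGate`, crux `RecordZoomAncient` (stmt-NavierStokesRegularity-0894),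
  line `registered` (birth skeleton, reshape r2) — stub `stub_zoomLimit`

**Statement.** For a classical solution `(u, p)` of the unforced Navier–Stokes system
(viscosity `ν`) on `ℝ³ × [0, T)`, Leray–Hopf from `u 0`, base times `tc n ∈ (0, T)`, centres
`xc n` and levels `L n > 0` with `∫ |∇u(t)|² ≤ L n` on `[0, tc n]`, `tc n (L n)² → ∞`, and the
bound `‖u(t, x)‖ ≤ C L n/ν` on `[ν³/(L n)², tc n]`, the zooms
`z n (s, y) = (ν/L n) u(tc n + ν³ s/(L n)², xc n + (ν²/L n) y)` converge along a subsequence,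
pointwise on `(−∞, 0) × ℝ³`, to a bounded ancient mild solution `v` (`ν = 1`), smooth on
`(−∞, 0) × ℝ³`, with `∫ |∇v(s)|² ≤ 1` and `v(s) ∈ L⁶` for all `s < 0`.

**Proof (KNSS 2009, Lemma 6.1).** Each zoom is a classical solution with viscosity `1`
(`IsClassicalNSSolutionOn.stRescale`) on the window `(A n, b n)`, `A n = 1 − tc n (L n)²/ν³ → −∞`,
`b n > 0`; on `(A n, 0]` it is bounded by `C`, has `L²`-bounded slices (Leray–Hopf energy bound
and change of variables), enstrophy `E/L n ≤ 1` and hence `‖z n(s)‖₆ ≤ C_S` (Sobolev), so it is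
Oseen-mild there (`mild_of_bounded_of_eLpNorm_two_le_of_lt`). `KNSS2009_lemma61_oseenMild`
extracts a pointwise convergent subsequence with an ancient Oseen-mild limit: a bounded ancient
mild solution (`isBoundedAncientMildSolution_of_oseen`), jointly smooth
(`HardyAncientLimit.isSmoothSpaceTimeOn_of_oseen`, KNSS 2009 Prop. 4.1), with `L⁶` slices (Fatou)
and enstrophy `≤ 1` by the lower semicontinuity of `∫ |∇·|²` under bounded pointwise convergence
of `C¹` fields (`lintegral_frobeniusNormSq_fderiv_le_of_tendsto_of_bound`, the argument of
Ożański–Pooley 2018, Thm. 6.37, Step 3: weak `L²` compactness of the gradients, identification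
of the weak limit as the weak gradient of the limit, a.e. uniqueness of weak gradients).

Sources: G. Koch, N. Nadirashvili, G. Seregin, V. Šverák, Acta Math. 203 (2009), Lemma 6.1,
Prop. 4.1, §6 (6.2); W. S. Ożański, B. C. Pooley, LMS Lecture Notes 452 (2018), proof of
Thm. 6.37, Step 3; L. C. Evans, *PDE*, §5.2.1, §5.6.1.
-/

noncomputable section

open Set MeasureTheory Filter Topology Function TopologicalSpace Literature.Analysis.FluidPDE
open scoped ENNReal NNReal InnerProductSpace RealInnerProductSpace

namespace Summit.NavierStokesRegularity.NavierStokesRegularity.Theorems.RecordZoomAncient.Birth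

-- the problem-side namespace `Summit.NavierStokesRegularity.NavierStokesRegularity.…` (summit =
-- problem for this single-problem summit) duplicates `NavierStokesRegularity` by design
set_option linter.dupNamespace false

section Tools

variable {E : Type*} [NormedAddCommGroup E] [InnerProductSpace ℝ E] [FiniteDimensional ℝ E]
  [MeasurableSpace E] [BorelSpace E]

/-- **Change of variables in `L^p`** under `y ↦ x₀ + γ y`, `γ > 0`:
`‖f(x₀ + γ ·)‖_{L^p} = (γⁿ)^{-1/p} ‖f‖_{L^p}` (`map_space_affine_volume`). [folklore] -/
theorem eLpNorm_comp_space_affine {F : Type*} [NormedAddCommGroup F] {γ : ℝ} (hγ : 0 < γ)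
    (x₀ : E) (f : E → F) (p : ℝ≥0∞) :
    eLpNorm (fun y => f (x₀ + γ • y)) p volume =
      ENNReal.ofReal (γ ^ Module.finrank ℝ E)⁻¹ ^ (1 / p).toReal * eLpNorm f p volume := by
  have hemb : MeasurableEmbedding (fun y : E => x₀ + γ • y) := by
    have h := (spaceAffineHomeomorph hγ.ne' x₀).measurableEmbedding
    rwa [coe_spaceAffineHomeomorph] at h
  have h0 : ENNReal.ofReal (γ ^ Module.finrank ℝ E)⁻¹ ≠ 0 :=
    (ENNReal.ofReal_pos.2 (by positivity)).ne'
  rw [← Function.comp_def f, ← hemb.eLpNorm_map_measure, map_space_affine_volume hγ x₀,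
    eLpNorm_smul_measure_of_ne_zero h0, smul_eq_mul]

/-- **The Dirichlet integral of a zoomed field**: for differentiable `f : E → E` and `γ > 0`,
`∫ |∇(α f(x₀ + γ ·))|² = (α γ)² (γⁿ)⁻¹ ∫ |∇f|²` (chain rule, `lintegral_comp_space_affine`).
[folklore] -/
theorem lintegral_frobeniusNormSq_fderiv_smul_comp_space_affine {γ : ℝ} (hγ : 0 < γ) (α : ℝ)
    (x₀ : E) {f : E → E} (hf : Differentiable ℝ f) :
    ∫⁻ y, ENNReal.ofReal (frobeniusNormSq (fderiv ℝ (α • fun y => f (x₀ + γ • y)) y)) =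
      ENNReal.ofReal ((α * γ) ^ 2) * ENNReal.ofReal (γ ^ Module.finrank ℝ E)⁻¹ *
        ∫⁻ x, ENNReal.ofReal (frobeniusNormSq (fderiv ℝ f x)) := by
  have hg : Differentiable ℝ fun y : E => f (x₀ + γ • y) :=
    hf.comp ((differentiable_const _).add (differentiable_id.const_smul γ))
  have hD : ∀ y, fderiv ℝ (α • fun y => f (x₀ + γ • y)) y =
      (α * γ) • fderiv ℝ f (x₀ + γ • y) := by
    intro y
    rw [fderiv_const_smul (hg y)]
    have h := fderiv_comp_smul (𝕜 := ℝ) (f := fun x => f (x₀ + x)) (x := y) γ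
    rw [fderiv_comp_add_left] at h
    rw [h, smul_smul]
  simp_rw [hD, frobeniusNormSq_smul, ENNReal.ofReal_mul (sq_nonneg _)]
  rw [lintegral_const_mul' _ _ ENNReal.ofReal_ne_top,
    lintegral_comp_space_affine hγ x₀ (fun x => ENNReal.ofReal (frobeniusNormSq (fderiv ℝ f x))),
    mul_assoc]

/-- **Lower semicontinuity of `∫ |∇·|²` under bounded pointwise convergence of `C¹` fields**:
if `C¹` fields `f n` with `‖f n(x)‖ ≤ C`, `∫ |∇f n|² ≤ D` converge pointwise to a `C¹` field `f`,
then `∫ |∇f|² ≤ D` — a weak `L²` limit `g` of the gradient tuples, `‖g‖₂² ≤ D`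
(`exists_subseq_weakLimit_of_sq_le`), is a weak gradient of `f` (dominated convergence in the
integration-by-parts identities), hence a.e. `∇f` (`HasWeakFDerivOn.unique_holds`); the proof
of the tree's `exists_hasWeakGradient_of_tendsto_eLpNorm` (Ożański–Pooley 2018, Thm. 6.37,
Step 3) with strong `L²` convergence replaced by bounded pointwise convergence. [folklore] -/
theorem lintegral_frobeniusNormSq_fderiv_le_of_tendsto_of_bound {f : ℕ → E → E} {fl : E → E}
    {C : ℝ} {D : ℝ≥0} (hf1 : ∀ n, ContDiff ℝ 1 (f n)) (hfl : ContDiff ℝ 1 fl)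
    (hbd : ∀ n x, ‖f n x‖ ≤ C) (hconv : ∀ x, Tendsto (fun n => f n x) atTop (𝓝 (fl x)))
    (hD : ∀ n, ∫⁻ x, ENNReal.ofReal (frobeniusNormSq (fderiv ℝ (f n) x)) ≤ D) :
    ∫⁻ x, ENNReal.ofReal (frobeniusNormSq (fderiv ℝ fl x)) ≤ D := by
  -- ### Step A: the gradient tuples and their weak limit
  have hfin : ∀ k, ∫⁻ x, ENNReal.ofReal (frobeniusNormSq (fderiv ℝ (f k) x)) < ∞ := fun k =>
    (hD k).trans_lt ENNReal.coe_lt_top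
  set w : ℕ → E → GradTuple E := fun k => gradTuple (f k) with hw_def
  have hw : ∀ k, MemLp (w k) 2 (volume : Measure E) := fun k => memLp_gradTuple (hf1 k) (hfin k)
  have hb : ∀ k, ‖(hw k).toLp (w k)‖ ^ 2 ≤ (D : ℝ) + 1 / ((k : ℝ) + 1) := fun k => by
    rw [Lp.norm_toLp, ← ENNReal.toReal_pow, eLpNorm_gradTuple_sq]
    have h1 : (∫⁻ x, ENNReal.ofReal (frobeniusNormSq (fderiv ℝ (f k) x))).toReal ≤ (D : ℝ) := by
      have h := ENNReal.toReal_mono ENNReal.coe_ne_top (hD k)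
      rwa [ENNReal.coe_toReal] at h
    have h2 : (0 : ℝ) ≤ 1 / ((k : ℝ) + 1) := by positivity
    linarith
  obtain ⟨κ, g, hg, hκ, hgL, hweak⟩ := exists_subseq_weakLimit_of_sq_le hw D.coe_nonneg hb
  -- ### Step B: the candidate weak gradient and its dissipation
  have hG2 : MemLp (tupleToCLM g) 2 (volume : Measure E) := memLp_tupleToCLM hg
  have hGD : ∫⁻ x, ENNReal.ofReal (frobeniusNormSq (tupleToCLM g x)) ≤ D := by
    rw [lintegral_frobeniusNormSq_tupleToCLM]
    have h1 : eLpNorm g 2 (volume : Measure E) = ENNReal.ofReal ‖hg.toLp g‖ := by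
      rw [Lp.norm_toLp, ENNReal.ofReal_toReal hg.eLpNorm_ne_top]
    rw [h1, ← ENNReal.ofReal_pow (norm_nonneg _), ← ENNReal.ofReal_coe_nnreal]
    exact ENNReal.ofReal_le_ofReal hgL
  -- ### Step C: `tupleToCLM g` is a weak gradient of the limit
  have hWG : HasWeakGradient fl (tupleToCLM g) := by
    refine ⟨(hfl.continuous.locallyIntegrable).locallyIntegrableOn _,
      (hG2.locallyIntegrable one_le_two).locallyIntegrableOn _, fun θ v hθ => ?_⟩
    simp only [TopologicalSpace.Opens.coe_top, Measure.restrict_univ]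
    have hθc : Continuous θ := hθ.contDiff.continuous
    have hdθc : Continuous fun x => fderiv ℝ θ x v :=
      (hθ.contDiff.continuous_fderiv (by simp)).clm_apply continuous_const
    have hdθs : HasCompactSupport fun x => fderiv ℝ θ x v :=
      hθ.hasCompactSupport.fderiv_apply (𝕜 := ℝ) v
    have hθ2 : MemLp θ 2 (volume : Measure E) := memLp_of_isTestFunctionOn_real hθ 2
    have iL : Integrable (fun x => (fderiv ℝ θ x v) • fl x) volume :=
      (hdθc.smul hfl.continuous).integrable_of_hasCompactSupport hdθs.smul_right
    have iR : Integrable (fun x => θ x • tupleToCLM g x v) volume :=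
      integrable_smul_of_memLp_two hθ2 (memLp_clm_apply hG2 v)
    refine ext_inner_left ℝ fun c => ?_
    rw [inner_neg_right, ← integral_inner iL c, ← integral_inner iR c]
    -- the identities of the approximants
    have hidk : ∀ k, ∫ x, ⟪c, (fderiv ℝ θ x v) • f (κ k) x⟫ =
        -∫ x, ⟪w (κ k) x, testTuple θ v c x⟫ := by
      intro k
      have hk := (hasWeakGradient_fderiv_of_contDiff (hf1 (κ k))).integral_fderiv_smul_eq θ v hθ
      simp only [TopologicalSpace.Opens.coe_top, Measure.restrict_univ] at hk
      have iLk : Integrable (fun x => (fderiv ℝ θ x v) • f (κ k) x) volume :=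
        (hdθc.smul (hf1 (κ k)).continuous).integrable_of_hasCompactSupport hdθs.smul_right
      have hcont : Continuous fun x => fderiv ℝ (f (κ k)) x v :=
        ((hf1 (κ k)).continuous_fderiv one_ne_zero).clm_apply continuous_const
      have iRk : Integrable (fun x => θ x • fderiv ℝ (f (κ k)) x v) volume :=
        (hθc.smul hcont).integrable_of_hasCompactSupport hθ.hasCompactSupport.smul_right
      rw [integral_inner iLk c, hk, inner_neg_right, ← integral_inner iRk c]
      congr 1
      refine integral_congr_ae (Eventually.of_forall fun x => ?_)
      show ⟪c, θ x • fderiv ℝ (f (κ k)) x v⟫ = ⟪w (κ k) x, testTuple θ v c x⟫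
      rw [hw_def]
      simp only
      rw [← tupleToCLM_gradTuple_apply, real_inner_smul_right, real_inner_comm,
        ← real_inner_smul_right, inner_tupleToCLM_apply_smul]
    -- the left-hand sides converge by dominated convergence
    have hlhs : Tendsto (fun k => ∫ x, ⟪c, (fderiv ℝ θ x v) • f (κ k) x⟫) atTop
        (𝓝 (∫ x, ⟪c, (fderiv ℝ θ x v) • fl x⟫)) := by
      refine tendsto_integral_of_dominated_convergence
        (fun x => ‖c‖ * (‖fderiv ℝ θ x v‖ * C)) ?_ ?_ ?_ ?_
      · exact fun k =>
          (continuous_const.inner (hdθc.smul (hf1 (κ k)).continuous)).aestronglyMeasurable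
      · exact (continuous_const.mul (hdθc.norm.mul continuous_const)).integrable_of_hasCompactSupport
          (hdθs.norm.mul_right).mul_left
      · intro k
        refine Eventually.of_forall fun x => ?_
        calc ‖⟪c, (fderiv ℝ θ x v) • f (κ k) x⟫‖ ≤ ‖c‖ * ‖(fderiv ℝ θ x v) • f (κ k) x‖ :=
              norm_inner_le_norm _ _
          _ ≤ ‖c‖ * (‖fderiv ℝ θ x v‖ * C) := by
              rw [norm_smul]
              exact mul_le_mul_of_nonneg_left
                (mul_le_mul_of_nonneg_left (hbd _ _) (norm_nonneg _)) (norm_nonneg _)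
      · exact Eventually.of_forall fun x =>
          tendsto_const_nhds.inner
            (tendsto_const_nhds.smul ((hconv x).comp hκ.tendsto_atTop))
    have hrhs : Tendsto (fun k => -∫ x, ⟪w (κ k) x, testTuple θ v c x⟫) atTop
        (𝓝 (-∫ x, ⟪g x, testTuple θ v c x⟫)) := (hweak _ (memLp_testTuple hθ v c)).neg
    have hA := tendsto_nhds_unique hlhs (hrhs.congr fun k => (hidk k).symm)
    rw [hA]
    congr 1
    refine integral_congr_ae (Eventually.of_forall fun x => ?_)
    show ⟪g x, testTuple θ v c x⟫ = ⟪c, θ x • tupleToCLM g x v⟫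
    rw [real_inner_smul_right, ← real_inner_comm c (tupleToCLM g x v), ← real_inner_smul_right,
      inner_tupleToCLM_apply_smul]
  -- ### Step D: uniqueness of weak gradients
  have hae : tupleToCLM g =ᵐ[volume] fderiv ℝ fl := by
    have h := Literature.Analysis.FunctionSpaces.HasWeakFDerivOn.unique_holds hWG
      (hasWeakGradient_fderiv_of_contDiff hfl)
    simpa [Measure.restrict_univ] using h
  calc ∫⁻ x, ENNReal.ofReal (frobeniusNormSq (fderiv ℝ fl x))
      = ∫⁻ x, ENNReal.ofReal (frobeniusNormSq (tupleToCLM g x)) := by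
        refine lintegral_congr_ae ?_
        filter_upwards [hae] with x hx
        rw [hx]
    _ ≤ D := hGD

end Tools

/-- **stub 3b — `stub_zoomLimit` (KNSS 2009, Lemma 6.1-type compactness of the
enstrophy-normalised zooms; statement and proof in the module docstring).** -/
theorem stub_zoomLimit :
    ∀ (ν T : ℝ), 0 < ν → 0 < T →
      ∀ (u : ℝ → EuclideanSpace ℝ (Fin 3) → EuclideanSpace ℝ (Fin 3)) (p : ℝ → EuclideanSpace ℝ (Fin 3) → ℝ),
        IsClassicalNSSolutionOn (Set.Ico 0 T) ν 0 u p → IsLerayHopfOn T ν 0 (u 0) u →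
        HasRapidSpatialDecay (u 0) →
        (∀ T' ∈ Set.Ioo 0 T, ∃ P : ℝ → EuclideanSpace ℝ (Fin 3) → ℝ, IsTaoSolutionOn T' ν (u 0) u P) →
        ∀ (tc : ℕ → ℝ) (xc : ℕ → EuclideanSpace ℝ (Fin 3)) (L : ℕ → ℝ),
          (∀ n, 0 < tc n ∧ tc n < T) → (∀ n, 0 < L n) →
          (∀ n, ∀ t ∈ Set.Icc 0 (tc n),
            ∫⁻ x, ENNReal.ofReal (frobeniusNormSq (fderiv ℝ (u t) x)) ≤ ENNReal.ofReal (L n)) →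
          Tendsto (fun n => tc n * L n ^ 2) atTop atTop →
          ∀ C : ℝ, (∀ n, ∀ t ∈ Set.Icc (ν ^ 3 / L n ^ 2) (tc n), ∀ x, ‖u t x‖ ≤ C * L n / ν) →
          ∀ (z : ℕ → ℝ → EuclideanSpace ℝ (Fin 3) → EuclideanSpace ℝ (Fin 3)),
            (∀ n s y, z n s y = (ν / L n) • u (tc n + ν ^ 3 / L n ^ 2 * s) (xc n + (ν ^ 2 / L n) • y)) →
            ∃ (φ : ℕ → ℕ) (v : ℝ → EuclideanSpace ℝ (Fin 3) → EuclideanSpace ℝ (Fin 3)), StrictMono φ ∧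
              (∀ s < 0, ∀ y, Tendsto (fun n => z (φ n) s y) atTop (𝓝 (v s y))) ∧
              IsBoundedAncientMildSolution 1 v ∧
              ContDiffOn ℝ (⊤ : ℕ∞) (Function.uncurry v) (Set.Iio 0 ×ˢ Set.univ) ∧
              (∀ s < 0, ∫⁻ y, ENNReal.ofReal (frobeniusNormSq (fderiv ℝ (v s) y)) ≤ 1) ∧
              (∀ s < 0, MemLp (v s) 6 volume) := by
  intro ν T hν _hT u p hcl hLH _hdec _hrep tc xc L htc hL hdom hprod C hbd z hz
  -- ### scales `α = ν/L`, `γ = ν²/L`, `β = α γ = ν³/L²` (viscosity `α ν/γ = 1`), windows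
  have hν3 : 0 < ν ^ 3 := pow_pos hν 3
  have hαpos : ∀ n, 0 < ν / L n := fun n => div_pos hν (hL n)
  have hγpos : ∀ n, 0 < ν ^ 2 / L n := fun n => div_pos (pow_pos hν 2) (hL n)
  have hβpos : ∀ n, 0 < ν ^ 3 / L n ^ 2 := fun n => div_pos hν3 (pow_pos (hL n) 2)
  obtain ⟨A, hA⟩ : ∃ A : ℕ → ℝ, ∀ n, A n = 1 - tc n * L n ^ 2 / ν ^ 3 := ⟨_, fun n => rfl⟩
  obtain ⟨b, hb⟩ : ∃ b : ℕ → ℝ, ∀ n, b n = (T - tc n) * L n ^ 2 / ν ^ 3 := ⟨_, fun n => rfl⟩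
  have halg : ∀ n s, ν ^ 3 / L n ^ 2 = ν / L n * (ν ^ 2 / L n) ∧
      ν / L n * ν / (ν ^ 2 / L n) = 1 ∧ ν / L n * (C * L n / ν) = C ∧
      (ν / L n * (ν ^ 2 / L n)) ^ 2 * ((ν ^ 2 / L n) ^ 3)⁻¹ * L n = 1 ∧
      tc n + ν ^ 3 / L n ^ 2 * s = ν ^ 3 / L n ^ 2 + ν ^ 3 / L n ^ 2 * (s - A n) ∧
      T - (tc n + ν ^ 3 / L n ^ 2 * s) = ν ^ 3 / L n ^ 2 * (b n - s) := by
    intro n s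
    have hLn : L n ≠ 0 := (hL n).ne'
    have hν0 : ν ≠ 0 := hν.ne'
    rw [hA n, hb n]
    refine ⟨?_, ?_, ?_, ?_, ?_, ?_⟩ <;> field_simp <;> ring
  have hbpos : ∀ n, 0 < b n := fun n =>
    (hb n).symm ▸ div_pos (mul_pos (sub_pos.2 (htc n).2) (pow_pos (hL n) 2)) hν3
  have hs_lt_b : ∀ n s, s ≤ 0 → s < b n := fun n s hs => lt_of_le_of_lt hs (hbpos n)
  -- original times of rescaled times
  have hmem_Ico : ∀ n s, A n < s → s < b n → tc n + ν ^ 3 / L n ^ 2 * s ∈ Ico 0 T := by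
    intro n s h1 h2
    obtain ⟨-, -, -, -, hoA, hob⟩ := halg n s
    have h3 : 0 < ν ^ 3 / L n ^ 2 * (s - A n) := mul_pos (hβpos n) (by linarith)
    have h4 : 0 < ν ^ 3 / L n ^ 2 * (b n - s) := mul_pos (hβpos n) (by linarith)
    constructor <;> linarith [hβpos n]
  have hmem_Icc : ∀ n s, A n < s → s ≤ 0 →
      tc n + ν ^ 3 / L n ^ 2 * s ∈ Icc (ν ^ 3 / L n ^ 2) (tc n) := by
    intro n s h1 h2
    obtain ⟨-, -, -, -, hoA, -⟩ := halg n s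
    have h3 : 0 ≤ ν ^ 3 / L n ^ 2 * (s - A n) := mul_nonneg (hβpos n).le (by linarith)
    have h4 : ν ^ 3 / L n ^ 2 * s ≤ 0 := mul_nonpos_of_nonneg_of_nonpos (hβpos n).le h2
    constructor <;> linarith
  have hmem_Icc0 : ∀ n s, A n < s → s ≤ 0 → tc n + ν ^ 3 / L n ^ 2 * s ∈ Icc 0 (tc n) :=
    fun n s h1 h2 => ⟨(hβpos n).le.trans (hmem_Icc n s h1 h2).1, (hmem_Icc n s h1 h2).2⟩
  -- ### the zooms are classical solutions with viscosity `1` on `(A n, b n)`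
  have hzslice : ∀ n s, z n s =
      (ν / L n) • fun y => u (tc n + ν ^ 3 / L n ^ 2 * s) (xc n + (ν ^ 2 / L n) • y) :=
    fun n s => funext fun y => hz n s y
  have hzeq : ∀ n, z n = (ν / L n) • stPull (ν ^ 3 / L n ^ 2) (ν ^ 2 / L n) (tc n) (xc n) u :=
    fun n => funext fun s => funext fun y => by rw [hz n s y]; rfl
  have hclz : ∀ n, IsClassicalNSSolutionOn (Ioo (A n) (b n)) 1 0 (z n)
      ((ν / L n) ^ 2 • stPull (ν ^ 3 / L n ^ 2) (ν ^ 2 / L n) (tc n) (xc n) p) := by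
    intro n
    obtain ⟨hβeq, hvisc, -⟩ := halg n 0
    have h := hcl.stRescale (hαpos n) (hγpos n) hβeq (tc n) (xc n)
    rw [smul_stPull_zero, hvisc, ← hzeq n] at h
    exact h.mono (fun s hs => hmem_Ico n s hs.1 hs.2) (uniqueDiffOn_Ioo _ _)
  have hC1z : ∀ n s, s ∈ Ioo (A n) (b n) → ContDiff ℝ 1 (z n s) := fun n s hs =>
    ((hclz n).contDiff_velocity hs).of_le (by norm_cast)
  -- ### the inputs of KNSS 2009, Lemma 6.1
  have hAlim : Tendsto A atTop atBot := by
    have h1 : Tendsto (fun n => tc n * L n ^ 2 / ν ^ 3 + (-1)) atTop atTop :=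
      tendsto_atTop_add_const_right _ _ (hprod.atTop_div_const hν3)
    refine (tendsto_neg_atTop_atBot.comp h1).congr fun n => ?_
    rw [hA n, Function.comp_apply]
    ring
  have hcontz : ∀ n, ContinuousOn (uncurry (z n)) (Ioo (A n) 0 ×ˢ univ) := fun n =>
    (hclz n).smooth_velocity.continuousOn.mono
      (prod_mono (Ioo_subset_Ioo_right (hbpos n).le) subset_rfl)
  have hdivz : ∀ n, ∀ s ∈ Ioo (A n) 0, IsWeaklyDivFree (z n s) := fun n s hs =>
    VectorCalculus.IsDivFree.isWeaklyDivFree_holds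
      ((hclz n).divFree s ⟨hs.1, hs_lt_b n s hs.2.le⟩) (hC1z n s ⟨hs.1, hs_lt_b n s hs.2.le⟩)
  have hzb : ∀ n s, A n < s → s ≤ 0 → ∀ y, ‖z n s y‖ ≤ C := by
    intro n s h1 h2 y
    obtain ⟨-, -, hC, -⟩ := halg n s
    rw [hz n s y, norm_smul, Real.norm_of_nonneg (hαpos n).le, ← hC]
    exact mul_le_mul_of_nonneg_left (hbd n _ (hmem_Icc n s h1 h2) _) (hαpos n).le
  -- `L²` bounds of the zoom slices (Leray–Hopf energy bound and change of variables)
  obtain ⟨E2, hE2top, hE2⟩ : ∃ E2 : ℝ≥0∞, E2 ≠ ∞ ∧ ∀ t ∈ Icc 0 T, eLpNorm (u t) 2 volume ≤ E2 := by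
    refine ⟨ENNReal.ofReal (Real.sqrt (2 * VectorCalculus.kineticEnergy (u 0))),
      ENNReal.ofReal_ne_top, fun t ht => (ENNReal.pow_le_pow_left_iff two_ne_zero).1 ?_⟩
    rw [eLpNorm_two_sq_eq_lintegral, ← ENNReal.ofReal_pow (Real.sqrt_nonneg _),
      Real.sq_sqrt (mul_nonneg zero_le_two (kineticEnergy_nonneg _))]
    exact hLH.lintegral_enorm_sq_le hν.le ht
  have hKz : ∀ n, ∃ K : ℝ≥0∞, K ≠ ∞ ∧ ∀ s, A n < s → s ≤ 0 → eLpNorm (z n s) 2 volume ≤ K := by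
    intro n
    refine ⟨‖ν / L n‖ₑ *
      (ENNReal.ofReal ((ν ^ 2 / L n) ^ Module.finrank ℝ (EuclideanSpace ℝ (Fin 3)))⁻¹ ^
        (1 / (2 : ℝ≥0∞)).toReal * E2), ?_, fun s h1 h2 => ?_⟩
    · exact ENNReal.mul_ne_top enorm_ne_top (ENNReal.mul_ne_top
        (ENNReal.rpow_ne_top_of_nonneg ENNReal.toReal_nonneg ENNReal.ofReal_ne_top) hE2top)
    · rw [hzslice n s, eLpNorm_const_smul, eLpNorm_comp_space_affine (hγpos n) (xc n) _ 2]
      gcongr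
      exact hE2 _ ⟨(hmem_Icc0 n s h1 h2).1, (hmem_Icc0 n s h1 h2).2.trans (htc n).2.le⟩
  -- the Oseen identity of each zoom between negative times of its bounded region
  have hmildz : ∀ n, ∀ s t : ℝ, A n < s → s < t → t < 0 → ∀ x,
      z n t x = Literature.Analysis.UnboundedOperators.heatExtension (z n s) (t - s) x -
        oseenDuhamel 1 s (z n) (z n) t x := by
    intro n s t h1 h2 h3 x
    obtain ⟨K, hKtop, hK⟩ := hKz n
    exact mild_of_bounded_of_eLpNorm_two_le_of_lt (hclz n) (h1.trans (h2.trans h3)) (hbpos n)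
      (fun τ hτ y => hzb n τ hτ.1 hτ.2 y) hKtop (fun τ hτ => hK τ hτ.1 hτ.2) h1 h2 h3 x
  -- enstrophy `≤ 1` and the Sobolev `L⁶` bound of the zoom slices on the dominated past
  have hDz : ∀ n s, A n < s → s ≤ 0 →
      ∫⁻ y, ENNReal.ofReal (frobeniusNormSq (fderiv ℝ (z n s) y)) ≤ 1 := by
    intro n s h1 h2
    have ht := hmem_Icc0 n s h1 h2
    have htT : tc n + ν ^ 3 / L n ^ 2 * s ∈ Ico 0 T := ⟨ht.1, ht.2.trans_lt (htc n).2⟩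
    have hdiff : Differentiable ℝ (u (tc n + ν ^ 3 / L n ^ 2 * s)) :=
      (hcl.contDiff_velocity htT).differentiable (by simp)
    obtain ⟨-, -, -, h1eq, -⟩ := halg n s
    rw [hzslice n s,
      lintegral_frobeniusNormSq_fderiv_smul_comp_space_affine (hγpos n) (ν / L n) (xc n) hdiff]
    calc _ ≤ ENNReal.ofReal ((ν / L n * (ν ^ 2 / L n)) ^ 2) *
          ENNReal.ofReal ((ν ^ 2 / L n) ^ Module.finrank ℝ (EuclideanSpace ℝ (Fin 3)))⁻¹ *
          ENNReal.ofReal (L n) := by gcongr; exact hdom n _ ht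
      _ = 1 := by
        rw [finrank_euclideanSpace_fin, ← ENNReal.ofReal_mul (sq_nonneg _),
          ← ENNReal.ofReal_mul (mul_nonneg (sq_nonneg _)
            (inv_nonneg.2 (pow_nonneg (hγpos n).le _))), h1eq, ENNReal.ofReal_one]
  have hL6z : ∀ n s, A n < s → s ≤ 0 → eLpNorm (z n s) 6 volume ≤
      (SNormLESNormFDerivOfEqConst (EuclideanSpace ℝ (Fin 3))
        (volume : Measure (EuclideanSpace ℝ (Fin 3))) 2 : ℝ≥0∞) := by
    intro n s h1 h2
    have hs' : s ∈ Ioo (A n) (b n) := ⟨h1, hs_lt_b n s h2⟩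
    obtain ⟨K, hKtop, hK⟩ := hKz n
    have h2m : MemLp (z n s) 2 volume :=
      ⟨(hC1z n s hs').continuous.aestronglyMeasurable, (hK s h1 h2).trans_lt hKtop.lt_top⟩
    calc eLpNorm (z n s) 6 volume ≤ _ :=
          eLpNorm_six_le_frobenius_of_hasWeakGradient finrank_euclideanSpace_fin h2m
            (hasWeakGradient_fderiv_of_contDiff (hC1z n s hs'))
      _ ≤ SNormLESNormFDerivOfEqConst (EuclideanSpace ℝ (Fin 3))
            (volume : Measure (EuclideanSpace ℝ (Fin 3))) 2 * 1 ^ (1 / 2 : ℝ) := by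
          gcongr
          exact hDz n s h1 h2
      _ = _ := by rw [ENNReal.one_rpow, mul_one]
  -- ### KNSS 2009, Lemma 6.1: the subsequence and the ancient Oseen-mild limit
  obtain ⟨φ, W, hφ, hWc, hWdiv, hWb, hWmild, -, hpt, -⟩ :=
    KNSS2009_lemma61_oseenMild hAlim hcontz hdivz hmildz fun n τ hτ y => hzb n τ hτ.1 hτ.2.le y
  -- bounded ancient mild solution (duality form) and smoothness (KNSS 2009, Prop. 4.1)
  have hmildW : IsBoundedAncientMildSolution 1 W :=
    isBoundedAncientMildSolution_of_oseen one_pos hWc ⟨C, hWb⟩ hWdiv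
      (fun s t hst ht x => by rw [one_mul]; exact hWmild s t hst ht x)
  have hsm : IsSmoothSpaceTimeOn (Iio 0) W :=
    HardyAncientLimit.isSmoothSpaceTimeOn_of_oseen hWc
      ((norm_nonneg _).trans (hWb (-1) (by norm_num) 0)) hWb hWmild
  -- a negative time eventually lies in the windows along the subsequence
  have hev : ∀ s : ℝ, s < 0 → ∃ N : ℕ, ∀ k, s ∈ Ioo (A (φ (k + N))) (b (φ (k + N))) := by
    intro s hs
    obtain ⟨N, hN⟩ := eventually_atTop.1
      ((hAlim.comp hφ.tendsto_atTop).eventually (eventually_lt_atBot s))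
    exact ⟨N, fun k => ⟨hN (k + N) (Nat.le_add_left N k), hs_lt_b _ s hs.le⟩⟩
  refine ⟨φ, W, hφ, hpt, hmildW, hsm, fun s hs => ?_, fun s hs => ?_⟩
  · -- enstrophy of the limit slices: lower semicontinuity
    obtain ⟨N, hN⟩ := hev s hs
    have hWs : ContDiff ℝ 1 (W s) := (hsm.contDiff_slice hs).of_le (by norm_cast)
    have h := lintegral_frobeniusNormSq_fderiv_le_of_tendsto_of_bound (D := 1) (C := C)
      (f := fun k => z (φ (k + N)) s) (fun k => hC1z _ s (hN k)) hWs
      (fun k y => hzb _ s (hN k).1 hs.le y)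
      (fun y => (hpt s hs y).comp (tendsto_add_atTop_nat N))
      (fun k => by rw [ENNReal.coe_one]; exact hDz _ s (hN k).1 hs.le)
    rwa [ENNReal.coe_one] at h
  · -- `L⁶` slices of the limit: Sobolev on the zoom slices and Fatou
    obtain ⟨N, hN⟩ := hev s hs
    refine ⟨(hsm.contDiff_slice hs).continuous.aestronglyMeasurable, ?_⟩
    calc eLpNorm (W s) 6 volume
        ≤ liminf (fun k => eLpNorm (z (φ (k + N)) s) 6 volume) atTop :=
          Lp.eLpNorm_lim_le_liminf_eLpNorm
            (fun k => (hC1z _ s (hN k)).continuous.aestronglyMeasurable) (W s)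
            (Eventually.of_forall fun y => (hpt s hs y).comp (tendsto_add_atTop_nat N))
      _ ≤ (SNormLESNormFDerivOfEqConst (EuclideanSpace ℝ (Fin 3))
            (volume : Measure (EuclideanSpace ℝ (Fin 3))) 2 : ℝ≥0∞) :=
          liminf_le_of_frequently_le'
            (Eventually.of_forall fun k => hL6z _ s (hN k).1 hs.le).frequently
      _ < ∞ := ENNReal.coe_lt_top

end Summit.NavierStokesRegularity.NavierStokesRegularity.Theorems.RecordZoomAncient.Birth

end
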